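import Literature.NumberTheory.LFunctions.WeilExplicit
import Literature.NumberTheory.LFunctions.WeilExplicitProofs
import Literature.NumberTheory.LFunctions.WeilMellinBounds

/-!
# Stub `stub_defectLowerBound` for crux `SignCone.OscCoherentCore` (line Sketch, item stmt-RiemannHypothesis-18013)

Per-zero DEFECT LOWER BOUND. For a Weil test `g`, `k = g ⋆ g̃ = weilConv g (weilReflect g)`,
`k̂ = weilMellin k` and any `ρ`, write `δ = Re ρ - 1/2`, `γ = Im ρ` and
`D := ∫ k(u) (2cosh(δu) - 2) e^{iγu} du`. Then `Re k̂(ρ) ≥ -½ ‖D‖`.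

Proof: pointwise `(2cosh(δu) - 2) e^{iγu} = e^{(ρ - 1/2)u} + e^{(1 - conj ρ - 1/2)u} - 2 e^{(1/2 + iγ - 1/2)u}`,
so by linearity of the integral (all three integrands are Weil integrands of the test function `k`,
`integrable_weilIntegrand`) `D = k̂(ρ) + k̂(1 - conj ρ) - 2 k̂(1/2 + iγ)`. Since `k` is self-adjoint
(`conj_weilConv_weilReflect_neg`), `k̂(1 - conj ρ) = conj k̂(ρ)` (`conj_weilMellin_of_selfAdjoint`), and
`k̂(1/2 + iγ) = |ĝ(1/2 + iγ)|² ≥ 0` (`weilMellin_weilQuadratic_of_re_eq`). Hence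
`Re D = 2 Re k̂(ρ) - 2 |ĝ(1/2 + iγ)|² ≤ 2 Re k̂(ρ)` and `Re D ≥ -‖D‖`.
Support lemma; it does not close the item.
-/

noncomputable section

-- `Summit.RiemannHypothesis.RiemannHypothesis.…` repeats a namespace component by design (D-0017 layout).
set_option linter.dupNamespace false

open scoped BigOperators ComplexConjugate Real
open Complex MeasureTheory Set Filter

namespace Summit.RiemannHypothesis.RiemannHypothesis.Theorems.OscCoherentCore

open Literature.NumberTheory.LFunctions

/-- Pointwise identity of the tilt kernels: for `ρ = 1/2 + δ + iγ` and real `u`,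
`(2cosh(δu) - 2) e^{iγu} = e^{(ρ - 1/2)u} + e^{(1 - conj ρ - 1/2)u} - 2 e^{(1/2 + iγ - 1/2)u}`
(`e^{(ρ-1/2)u} = e^{δu} e^{iγu}`, `e^{(1/2 - conj ρ)u} = e^{-δu} e^{iγu}`, `2cosh x = eˣ + e⁻ˣ`). [folklore] -/
theorem defectKernel_eq (ρ : ℂ) (u : ℝ) :
    ((2 * Real.cosh ((ρ.re - 1 / 2) * u) - 2 : ℝ) : ℂ) * cexp (↑(ρ.im * u) * I) =
      cexp ((ρ - 1 / 2) * u) + cexp ((1 - conj ρ - 1 / 2) * u) -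
        2 * cexp ((1 / 2 + ρ.im * I - 1 / 2) * u) := by
  have h1 : (ρ - 1 / 2) * (u : ℂ) =
      (((ρ.re - 1 / 2) * u : ℝ) : ℂ) + ((ρ.im * u : ℝ) : ℂ) * I := by
    apply Complex.ext <;> simp
  have h2 : (1 - conj ρ - 1 / 2) * (u : ℂ) =
      ((-((ρ.re - 1 / 2) * u) : ℝ) : ℂ) + ((ρ.im * u : ℝ) : ℂ) * I := by
    apply Complex.ext <;> simp
    ring
  have h3 : (1 / 2 + ρ.im * I - 1 / 2) * (u : ℂ) = ((ρ.im * u : ℝ) : ℂ) * I := by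
    apply Complex.ext <;> simp
  rw [h1, h2, h3, Complex.exp_add, Complex.exp_add, ← Complex.ofReal_exp, ← Complex.ofReal_exp,
    Real.cosh_eq]
  push_cast
  ring

/-- **Defect lower bound** (STUB A of line Sketch). For a Weil test `g`, `k = g ⋆ g̃` and any `ρ`,
`Re k̂(ρ) ≥ -½ ‖D_k(ρ)‖` with `D_k(ρ) = ∫ k(u)(2cosh(δu) - 2)e^{iγu} du`, `δ = Re ρ - 1/2`, `γ = Im ρ`:
`D_k(ρ) = k̂(ρ) + conj k̂(ρ) - 2 |ĝ(1/2 + iγ)|²` (`conj_weilMellin_of_selfAdjoint`,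
`weilMellin_weilQuadratic_of_re_eq`), so `Re D_k(ρ) ≤ 2 Re k̂(ρ)`. [folklore] -/
theorem stub_defectLowerBound :
    ∀ g : ℝ → ℂ, IsWeilTest g → ∀ ρ : ℂ,
      -(1 / 2 : ℝ) * ‖∫ u : ℝ, weilConv g (weilReflect g) u *
          ((2 * Real.cosh ((ρ.re - 1 / 2) * u) - 2 : ℝ) : ℂ) * cexp (↑(ρ.im * u) * I)‖ ≤
        (weilMellin (weilConv g (weilReflect g)) ρ).re := by
  intro g hg ρ
  set k : ℝ → ℂ := weilConv g (weilReflect g) with hk_def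
  have hk : IsWeilTest k := hg.weilConv hg.weilReflect
  have hint : ∀ s : ℂ, Integrable fun t : ℝ => k t * cexp ((s - 1 / 2) * t) :=
    fun s => integrable_weilIntegrand hk.1.continuous hk.2 s
  -- `D = k̂(ρ) + k̂(1 - conj ρ) - 2 k̂(1/2 + iγ)`
  have hD : (∫ u : ℝ, k u * ((2 * Real.cosh ((ρ.re - 1 / 2) * u) - 2 : ℝ) : ℂ) *
        cexp (↑(ρ.im * u) * I)) =
      weilMellin k ρ + weilMellin k (1 - conj ρ) - 2 * weilMellin k (1 / 2 + ρ.im * I) := by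
    have e : ∀ u : ℝ, k u * ((2 * Real.cosh ((ρ.re - 1 / 2) * u) - 2 : ℝ) : ℂ) *
          cexp (↑(ρ.im * u) * I) =
        (k u * cexp ((ρ - 1 / 2) * u) + k u * cexp ((1 - conj ρ - 1 / 2) * u)) -
          2 * (k u * cexp ((1 / 2 + ρ.im * I - 1 / 2) * u)) := by
      intro u
      rw [mul_assoc, defectKernel_eq]
      ring
    simp_rw [e]
    have i1 : Integrable fun u : ℝ =>
        k u * cexp ((ρ - 1 / 2) * u) + k u * cexp ((1 - conj ρ - 1 / 2) * u) :=
      (hint ρ).add (hint (1 - conj ρ))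
    have i2 : Integrable fun u : ℝ => 2 * (k u * cexp ((1 / 2 + ρ.im * I - 1 / 2) * u)) :=
      (hint (1 / 2 + ρ.im * I)).const_mul 2
    rw [integral_sub i1 i2, integral_add (hint ρ) (hint (1 - conj ρ)), integral_const_mul]
    rfl
  -- `k̂(1 - conj ρ) = conj k̂(ρ)` and `k̂(1/2 + iγ) = |ĝ(1/2 + iγ)|²`
  have hB : weilMellin k (1 - conj ρ) = conj (weilMellin k ρ) :=
    (conj_weilMellin_of_selfAdjoint (conj_weilConv_weilReflect_neg g) ρ).symm
  have hC : weilMellin k (1 / 2 + ρ.im * I) =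
      (Complex.normSq (weilMellin g (1 / 2 + ρ.im * I)) : ℂ) :=
    weilMellin_weilQuadratic_of_re_eq hg (by simp)
  have hre : (∫ u : ℝ, k u * ((2 * Real.cosh ((ρ.re - 1 / 2) * u) - 2 : ℝ) : ℂ) *
        cexp (↑(ρ.im * u) * I)).re =
      2 * (weilMellin k ρ).re - 2 * Complex.normSq (weilMellin g (1 / 2 + ρ.im * I)) := by
    rw [hD, hB, hC]
    simp only [Complex.sub_re, Complex.add_re, Complex.conj_re, Complex.mul_re, Complex.ofReal_re,
      Complex.ofReal_im, Complex.re_ofNat, Complex.im_ofNat, mul_zero, sub_zero]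
    ring
  have hnn : 0 ≤ Complex.normSq (weilMellin g (1 / 2 + ρ.im * I)) := Complex.normSq_nonneg _
  have habs := Complex.abs_re_le_norm
    (∫ u : ℝ, k u * ((2 * Real.cosh ((ρ.re - 1 / 2) * u) - 2 : ℝ) : ℂ) * cexp (↑(ρ.im * u) * I))
  rw [hre] at habs
  have h1 := (abs_le.1 habs).1
  linarith

end Summit.RiemannHypothesis.RiemannHypothesis.Theorems.OscCoherentCore

end
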